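import Mathlib
import Literature.Analysis.FluidPDE.TypeIAncientMild
import Literature.Analysis.FluidPDE.ClassicalSupStabilityForced
import Literature.Analysis.FluidPDE.KatoLocalBoundedPicard
import Literature.Analysis.FluidPDE.NSLerayBlowupRateLpProofs
import HarnessLib

/-!
# Census row A8t, line «pitch-defect»: the super-Type-I decay (stub S3b, lever form)

Support file for the scenario census of `NavierStokesRegularity` (row A8t, line «pitch-defect»,
stub S3b `stub_pitchDecay`; KEY-NS #101 (2)).

PROVED, `pitchDecay`: let `V ∈ IsTypeIAncientMild C'` be a genuine Type-I ancient mild field and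
`W` a field, jointly continuous on the open slab, with `‖W(τ)‖ ≤ C'/√(−τ)`, with the DEFECT bound
`‖V(τ) − W(τ)‖ ≤ D/(−τ)` (one power of `√(−τ)` below the Type-I scale — for the line, `W` is the
period average of the helical field `V`, `ScenarioCensusPitchDefectAverage.lean`) and whose own
Oseen bilinear term vanishes, `B¹ₛ(W,W)(t) = 0` a.e. for all `s < t < 0` («columnar swirl–axial
fields are Oseen-invisible», stub S3a2). Then `V` itself decays one power faster than Type I:
`‖V(t,y)‖ ≤ 4 c₀ C' D/(−t)` for all `t < 0`, `y` (`c₀ = oseenSliceConst`).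

Proof (no averaging and no Fubini is needed in this step): by the strong Oseen formula
`V(t) = e^{(t−s)Δ}V(s) − B¹ₛ(V,V)(t)` and the quadratic difference identity
`B(V,V) − B(W,W) = B(V−W, V) + B(W, V−W)` (`oseenDuhamel_self_sub_self`), at a.e. `y`
`‖V(t,y)‖ ≤ C'/√(−s) + ‖B(V−W,V)(t)(y)‖ + ‖B(W,V−W)(t)(y)‖`; the weighted sup bound
`norm_oseenDuhamel_le_setIntegral_visc` with slice bounds `D/(−τ)` and `C'/√(−τ)` and the
elementary Abel integral `∫ₛᵗ (t−τ)^{−1/2}(−τ)^{−3/2} dτ = (2/(−t))√((t−s)/(−s)) ≤ 2/(−t)`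
(`setIntegral_abel_threeHalves_le`, antiderivative `√(t−τ)/√(−τ)`) bound each bilinear term by
`2c₀C'D/(−t)` UNIFORMLY in `s`; letting `s → −∞` kills the free term (this is where «ancient +
time-Type-I» is spent), and continuity of the slice upgrades a.e. to everywhere.

No summit statement and no census row is proved here; nothing here is a claim about NS regularity.
-/

-- the summit and its single problem share the name (D-0017 nested layout)
set_option linter.dupNamespace false

noncomputable section

open MeasureTheory Set Function Filter Metric intervalIntegral
open scoped Topology ENNReal NNReal

namespace Summit.NavierStokesRegularity.NavierStokesRegularity.Theorems.ScenarioCensus.PitchDefect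

open Literature.Analysis Literature.Analysis.FluidPDE

/-! ### The Abel integral `∫ₛᵗ (t−τ)^{-1/2} (−τ)^{-3/2} dτ ≤ 2/(−t)` -/

/-- **The Abel integral of the lever**: for `s < t < 0` the kernel
`k(τ) = (√(t−τ))⁻¹ ((−τ)√(−τ))⁻¹` is integrable on `(s, t)` and
`∫_{(s,t)} k = (2/(−t)) √((t−s)/(−s)) ≤ 2/(−t)`: the function `g(τ) = −(2/(−t)) √(t−τ)/√(−τ)` has
`g' = k ≥ 0` on `(s,t)` (so `k` is integrable, `integrableOn_deriv_of_nonneg`) and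
`∫ₛᵗ k = g(t) − g(s) = (2/(−t))√((t−s)/(−s))`. [folklore] -/
theorem setIntegral_abel_threeHalves_le {s t : ℝ} (hst : s < t) (ht : t < 0) :
    IntegrableOn (fun τ : ℝ => (Real.sqrt (t - τ))⁻¹ * ((-τ) * Real.sqrt (-τ))⁻¹) (Ioo s t) volume ∧
      ∫ τ in Ioo s t, (Real.sqrt (t - τ))⁻¹ * ((-τ) * Real.sqrt (-τ))⁻¹ ≤ 2 / (-t) := by
  set k : ℝ → ℝ := fun τ => (Real.sqrt (t - τ))⁻¹ * ((-τ) * Real.sqrt (-τ))⁻¹ with hk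
  set g : ℝ → ℝ := fun τ => -(2 / (-t)) * (Real.sqrt (t - τ) / Real.sqrt (-τ)) with hg
  -- `g' = k` on `(s, t)`
  have hderiv : ∀ τ ∈ Ioo s t, HasDerivAt g (k τ) τ := by
    intro τ hτ
    have h1 : 0 < t - τ := sub_pos.2 hτ.2
    have h2 : 0 < -τ := by linarith [hτ.2]
    have ha : 0 < Real.sqrt (t - τ) := Real.sqrt_pos.2 h1
    have hb : 0 < Real.sqrt (-τ) := Real.sqrt_pos.2 h2
    have ha2 : Real.sqrt (t - τ) ^ 2 = t - τ := Real.sq_sqrt h1.le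
    have hb2 : Real.sqrt (-τ) ^ 2 = -τ := Real.sq_sqrt h2.le
    -- derivatives of the two square roots
    have hA : HasDerivAt (fun σ : ℝ => Real.sqrt (t - σ)) ((-1) / (2 * Real.sqrt (t - τ))) τ :=
      ((hasDerivAt_id τ).const_sub t).sqrt h1.ne'
    have hB : HasDerivAt (fun σ : ℝ => Real.sqrt (-σ)) ((-1) / (2 * Real.sqrt (-τ))) τ :=
      (hasDerivAt_neg τ).sqrt h2.ne'
    have hQ := (hA.div hB hb.ne').const_mul (-(2 / (-t)))
    refine hQ.congr_deriv ?_
    simp only [hk]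
    -- algebra in `a = √(t-τ)`, `b = √(-τ)`: `-t = b² - a²`, `-τ = b²`
    set a : ℝ := Real.sqrt (t - τ) with ha_def
    set b : ℝ := Real.sqrt (-τ) with hb_def
    have hab : b ^ 2 - a ^ 2 ≠ 0 := by rw [hb2, ha2]; linarith
    rw [show -t = b ^ 2 - a ^ 2 by rw [hb2, ha2]; ring, show -τ = b ^ 2 from hb2.symm]
    field_simp
    ring
  have hcont : ContinuousOn g (Icc s t) := by
    refine ContinuousOn.mul continuousOn_const (ContinuousOn.div ?_ ?_ fun τ hτ => ?_)
    · exact (Real.continuous_sqrt.comp (continuous_const.sub continuous_id)).continuousOn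
    · exact (Real.continuous_sqrt.comp continuous_neg).continuousOn
    · exact (Real.sqrt_pos.2 (by linarith [hτ.2])).ne'
  have hkpos : ∀ τ ∈ Ioo s t, 0 ≤ k τ := by
    intro τ hτ
    have h2 : 0 < -τ := by linarith [hτ.2]
    simp only [hk]
    exact mul_nonneg (inv_nonneg.2 (Real.sqrt_nonneg _))
      (inv_nonneg.2 (mul_nonneg h2.le (Real.sqrt_nonneg _)))
  have hint : IntegrableOn k (Ioc s t) volume :=
    integrableOn_deriv_of_nonneg hcont hderiv hkpos
  have hint' : IntegrableOn k (Ioo s t) volume := hint.mono_set Ioo_subset_Ioc_self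
  refine ⟨hint', ?_⟩
  have hFTC : ∫ τ in s..t, k τ = g t - g s :=
    intervalIntegral.integral_eq_sub_of_hasDerivAt_of_le hst.le hcont hderiv
      ((intervalIntegrable_iff_integrableOn_Ioc_of_le hst.le).2 hint)
  rw [← integral_Ioc_eq_integral_Ioo, ← intervalIntegral.integral_of_le hst.le, hFTC]
  -- `g t = 0`, `-g s = (2/(-t)) √(t-s)/√(-s) ≤ 2/(-t)`
  have hgt : g t = 0 := by simp [hg]
  have hs0 : 0 < -s := by linarith
  have hrat : Real.sqrt (t - s) / Real.sqrt (-s) ≤ 1 := by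
    rw [div_le_one (Real.sqrt_pos.2 hs0)]
    exact Real.sqrt_le_sqrt (by linarith)
  have ht0 : 0 < 2 / (-t) := div_pos two_pos (by linarith)
  rw [hgt, zero_sub, hg]
  simp only [neg_mul, neg_neg]
  calc 2 / (-t) * (Real.sqrt (t - s) / Real.sqrt (-s)) ≤ 2 / (-t) * 1 :=
        mul_le_mul_of_nonneg_left hrat ht0.le
    _ = 2 / (-t) := mul_one _

/-- The majorant of the lever's bilinear terms in the form consumed by
`norm_oseenDuhamel_le_setIntegral_visc` (`ν = 1`): for `s < t < 0` and `0 ≤ C', D`,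
`τ ↦ (1·(t−τ))^{-1/2} · (D/(−τ) · C'/√(−τ))` is integrable on `(s,t)` with integral
`≤ 2C'D/(−t)`. [folklore] -/
theorem lever_majorant {C' D s t : ℝ} (hC' : 0 ≤ C') (hD : 0 ≤ D) (hst : s < t) (ht : t < 0) :
    IntegrableOn (fun τ : ℝ => (1 * (t - τ)) ^ (-(1 / 2 : ℝ)) * (D / (-τ) * (C' / Real.sqrt (-τ))))
        (Ioo s t) volume ∧
      ∫ τ in Ioo s t, (1 * (t - τ)) ^ (-(1 / 2 : ℝ)) * (D / (-τ) * (C' / Real.sqrt (-τ))) ≤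
        2 * C' * D / (-t) := by
  obtain ⟨hint, hle⟩ := setIntegral_abel_threeHalves_le hst ht
  -- on `(s,t)` the majorant is `C' D` times the Abel kernel
  have heq : ∀ τ ∈ Ioo s t, (1 * (t - τ)) ^ (-(1 / 2 : ℝ)) * (D / (-τ) * (C' / Real.sqrt (-τ))) =
      C' * D * ((Real.sqrt (t - τ))⁻¹ * ((-τ) * Real.sqrt (-τ))⁻¹) := by
    intro τ hτ
    have h1 : 0 < t - τ := sub_pos.2 hτ.2
    have h2 : 0 < -τ := by linarith [hτ.2]
    rw [one_mul, Real.rpow_neg h1.le, ← Real.sqrt_eq_rpow]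
    field_simp
  refine ⟨?_, ?_⟩
  · exact IntegrableOn.congr_fun (hint.const_mul (C' * D)) (fun τ hτ => (heq τ hτ).symm)
      measurableSet_Ioo
  · rw [setIntegral_congr_fun measurableSet_Ioo heq, MeasureTheory.integral_const_mul]
    calc C' * D * ∫ τ in Ioo s t, (Real.sqrt (t - τ))⁻¹ * ((-τ) * Real.sqrt (-τ))⁻¹
        ≤ C' * D * (2 / (-t)) := mul_le_mul_of_nonneg_left hle (mul_nonneg hC' hD)
      _ = 2 * C' * D / (-t) := by ring

/-- **S3b, the lever (super-Type-I decay from the defect bound and Oseen-invisibility).** See the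
module docstring: `‖V(t,y)‖ ≤ 4c₀C'D/(−t)` for all `t < 0` and `y`, where
`c₀ = oseenSliceConst (EuclideanSpace ℝ (Fin 3))`. [cite: KochNadirashviliSereginSverak2009, §4 p. 8 (the bilinear form B and (4.3)–(4.4); arXiv:0709.3599)] -/
theorem pitchDecay {C' D : ℝ} (hD : 0 ≤ D)
    {V W : ℝ → EuclideanSpace ℝ (Fin 3) → EuclideanSpace ℝ (Fin 3)} (hV : IsTypeIAncientMild C' V)
    (hWc : ContinuousOn (uncurry W) (Iio 0 ×ˢ univ))
    (hWbd : ∀ τ < 0, ∀ y, ‖W τ y‖ ≤ C' / Real.sqrt (-τ))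
    (hdef : ∀ τ < 0, ∀ y, ‖V τ y - W τ y‖ ≤ D / (-τ))
    (hinv : ∀ s t : ℝ, s < t → t < 0 →
      ∀ᵐ y ∂(volume : Measure (EuclideanSpace ℝ (Fin 3))), oseenDuhamel 1 s W W t y = 0) :
    ∀ t < 0, ∀ y, ‖V t y‖ ≤
      4 * oseenSliceConst (EuclideanSpace ℝ (Fin 3)) * C' * D / (-t) := by
  set c₀ : ℝ := oseenSliceConst (EuclideanSpace ℝ (Fin 3)) with hc₀
  have hc₀0 : 0 ≤ c₀ := (oseenSliceConst_pos (E := EuclideanSpace ℝ (Fin 3))).le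
  have hC'0 : 0 ≤ C' := hV.nonneg
  intro t ht
  -- ## the bound at a.e. `y`, for every `s < t`
  have key : ∀ s : ℝ, s < t → ∀ᵐ y ∂(volume : Measure (EuclideanSpace ℝ (Fin 3))),
      ‖V t y‖ ≤ C' / Real.sqrt (-s) + 4 * c₀ * C' * D / (-t) := by
    intro s hst
    -- measurability and bounds on the slab `(s, t)`
    have hVm := hV.aestronglyMeasurable_uncurry (s := s) ht.le
    have hWm : AEStronglyMeasurable (uncurry W)
        ((volume : Measure (ℝ × EuclideanSpace ℝ (Fin 3))).restrict (Ioo s t ×ˢ univ)) :=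
      (hWc.mono (prod_mono (fun τ hτ => lt_trans hτ.2 ht) Subset.rfl)).aestronglyMeasurable
        (measurableSet_Ioo.prod MeasurableSet.univ)
    have hVb : ∀ τ ∈ Ioo s t, ∀ y, ‖V τ y‖ ≤ C' / Real.sqrt (-t) := fun τ hτ y =>
      hV.norm_le_of_mem_Ioo ht hτ y
    have hsq : ∀ τ ∈ Ioo s t, Real.sqrt (-t) ≤ Real.sqrt (-τ) := fun τ hτ =>
      Real.sqrt_le_sqrt (by linarith [hτ.2])
    have hWb : ∀ τ ∈ Ioo s t, ∀ y, ‖W τ y‖ ≤ C' / Real.sqrt (-t) := fun τ hτ y =>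
      (hWbd τ (hτ.2.trans ht) y).trans
        (div_le_div_of_nonneg_left hC'0 (Real.sqrt_pos.2 (by linarith)) (hsq τ hτ))
    -- the quadratic difference identity
    have hdiff : ∀ y, oseenDuhamel 1 s V V t y - oseenDuhamel 1 s W W t y =
        oseenDuhamel 1 s (fun τ z => V τ z - W τ z) V t y +
          oseenDuhamel 1 s W (fun τ z => V τ z - W τ z) t y := fun y =>
      oseenDuhamel_self_sub_self one_pos hVm hWm hVb hWb hst le_rfl y
    -- the two weighted bounds
    obtain ⟨hmaj, hmajle⟩ := lever_majorant hC'0 hD hst ht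
    have hB1 : ∀ y, ‖oseenDuhamel 1 s (fun τ z => V τ z - W τ z) V t y‖ ≤ 2 * c₀ * C' * D / (-t) := by
      intro y
      have h := norm_oseenDuhamel_le_setIntegral_visc (E := EuclideanSpace ℝ (Fin 3)) one_pos
        (a := fun τ z => V τ z - W τ z) (b := V) (Ma := fun τ => D / (-τ))
        (Mb := fun τ => C' / Real.sqrt (-τ)) (s := s) (t := t)
        (fun τ hτ z => hdef τ (hτ.2.trans ht) z) (fun τ hτ z => hV.norm_le (hτ.2.trans ht) z) hmaj y
      refine h.trans ?_
      calc oseenSliceConst (EuclideanSpace ℝ (Fin 3)) *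
            ∫ τ in Ioo s t, (1 * (t - τ)) ^ (-(1 / 2 : ℝ)) * (D / (-τ) * (C' / Real.sqrt (-τ)))
          ≤ c₀ * (2 * C' * D / (-t)) := mul_le_mul_of_nonneg_left hmajle hc₀0
        _ = 2 * c₀ * C' * D / (-t) := by ring
    have hB2 : ∀ y, ‖oseenDuhamel 1 s W (fun τ z => V τ z - W τ z) t y‖ ≤ 2 * c₀ * C' * D / (-t) := by
      intro y
      have hmaj' : IntegrableOn (fun τ : ℝ => (1 * (t - τ)) ^ (-(1 / 2 : ℝ)) *
          (C' / Real.sqrt (-τ) * (D / (-τ)))) (Ioo s t) volume := by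
        refine hmaj.congr_fun (fun τ _ => ?_) measurableSet_Ioo
        ring
      have h := norm_oseenDuhamel_le_setIntegral_visc (E := EuclideanSpace ℝ (Fin 3)) one_pos
        (a := W) (b := fun τ z => V τ z - W τ z) (Ma := fun τ => C' / Real.sqrt (-τ))
        (Mb := fun τ => D / (-τ)) (s := s) (t := t)
        (fun τ hτ z => hWbd τ (hτ.2.trans ht) z) (fun τ hτ z => hdef τ (hτ.2.trans ht) z) hmaj' y
      refine h.trans ?_
      have heq : ∫ τ in Ioo s t, (1 * (t - τ)) ^ (-(1 / 2 : ℝ)) * (C' / Real.sqrt (-τ) * (D / (-τ))) =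
          ∫ τ in Ioo s t, (1 * (t - τ)) ^ (-(1 / 2 : ℝ)) * (D / (-τ) * (C' / Real.sqrt (-τ))) := by
        refine setIntegral_congr_fun measurableSet_Ioo fun τ _ => ?_
        ring
      rw [heq]
      calc oseenSliceConst (EuclideanSpace ℝ (Fin 3)) *
            ∫ τ in Ioo s t, (1 * (t - τ)) ^ (-(1 / 2 : ℝ)) * (D / (-τ) * (C' / Real.sqrt (-τ)))
          ≤ c₀ * (2 * C' * D / (-t)) := mul_le_mul_of_nonneg_left hmajle hc₀0
        _ = 2 * c₀ * C' * D / (-t) := by ring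
    -- the free term
    have hfree : ∀ y, ‖UnboundedOperators.heatExtension (V s) (t - s) y‖ ≤ C' / Real.sqrt (-s) :=
      fun y => UnboundedOperators.norm_heatExtension_le (fun z => hV.norm_le (hst.trans ht) z)
        (sub_pos.2 hst) y
    filter_upwards [hinv s t hst ht] with y hy
    have hrepr : V t y = UnboundedOperators.heatExtension (V s) (t - s) y -
        (oseenDuhamel 1 s (fun τ z => V τ z - W τ z) V t y +
          oseenDuhamel 1 s W (fun τ z => V τ z - W τ z) t y) := by
      rw [← hdiff y, hy, sub_zero]
      exact hV.mild_eq_heatExtension hst ht y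
    rw [hrepr]
    calc ‖UnboundedOperators.heatExtension (V s) (t - s) y -
          (oseenDuhamel 1 s (fun τ z => V τ z - W τ z) V t y +
            oseenDuhamel 1 s W (fun τ z => V τ z - W τ z) t y)‖
        ≤ ‖UnboundedOperators.heatExtension (V s) (t - s) y‖ +
            (‖oseenDuhamel 1 s (fun τ z => V τ z - W τ z) V t y‖ +
              ‖oseenDuhamel 1 s W (fun τ z => V τ z - W τ z) t y‖) :=
          (norm_sub_le _ _).trans (add_le_add le_rfl (norm_add_le _ _))
      _ ≤ C' / Real.sqrt (-s) + (2 * c₀ * C' * D / (-t) + 2 * c₀ * C' * D / (-t)) :=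
          add_le_add (hfree y) (add_le_add (hB1 y) (hB2 y))
      _ = C' / Real.sqrt (-s) + 4 * c₀ * C' * D / (-t) := by ring
  -- ## `s → -∞` along `s_n = t - (n + 1)`, at a.e. `y`
  have hae : ∀ᵐ y ∂(volume : Measure (EuclideanSpace ℝ (Fin 3))),
      ‖V t y‖ ≤ 4 * c₀ * C' * D / (-t) := by
    have hall : ∀ᵐ y ∂(volume : Measure (EuclideanSpace ℝ (Fin 3))), ∀ n : ℕ,
        ‖V t y‖ ≤ C' / Real.sqrt (-(t - ((n : ℝ) + 1))) + 4 * c₀ * C' * D / (-t) := by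
      rw [ae_all_iff]
      intro n
      exact key (t - ((n : ℝ) + 1)) (by linarith [n.cast_nonneg (α := ℝ)])
    filter_upwards [hall] with y hy
    have hlim : Tendsto (fun n : ℕ => C' / Real.sqrt (-(t - ((n : ℝ) + 1))) + 4 * c₀ * C' * D / (-t))
        atTop (𝓝 (0 + 4 * c₀ * C' * D / (-t))) := by
      refine Tendsto.add ?_ tendsto_const_nhds
      have h1 : Tendsto (fun n : ℕ => Real.sqrt (-(t - ((n : ℝ) + 1)))) atTop atTop := by
        refine Real.tendsto_sqrt_atTop.comp ?_
        have : (fun n : ℕ => -(t - ((n : ℝ) + 1))) = fun n : ℕ => (n : ℝ) + (1 - t) := by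
          funext n; ring
        rw [this]
        exact tendsto_atTop_add_const_right _ _ tendsto_natCast_atTop_atTop
      have h2 := h1.inv_tendsto_atTop.const_mul C'
      rw [mul_zero] at h2
      refine h2.congr fun n => ?_
      simp only [Pi.inv_apply, div_eq_mul_inv]
    rw [zero_add] at hlim
    exact ge_of_tendsto' hlim hy
  -- ## everywhere, by continuity of the slice
  exact forall_norm_le_of_ae_norm_le (hV.continuous_slice ht) hae

end Summit.NavierStokesRegularity.NavierStokesRegularity.Theorems.ScenarioCensus.PitchDefect

end
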